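import Summits.CriticalPhenomena.PercolationContinuityZ3.Theorems.PercNearOneGluingAdditiveGluingTwoStepGlue
import HarnessLib

/-!
# Crux `PercNearOneGluing.AdditiveGluing` (stmt-CriticalPhenomena-4576): the three-relay E-form from the MIXTURE LEMMA 4 at one pair

Support file (`--supports stmt-CriticalPhenomena-4576`, lead c8, line `tieline` v16).  No definitions, no named facts, no sorries.

For a weighted graph, target `b`, a pair `{a₁, a₂}`, a spectator `c` and an observer `o` write `N = {c ↮ a₁} ∩ {c ↮ a₂}`,
`ψ_A = μ(N ∩ (o↔a₁ ∪ o↔a₂))`, `ψ_c = μ(N ∩ o↔c)` and `G_x = μ(x↮b ∩ (x↔a₁ ∪ x↔a₂) ∩ (a₁↔b ∪ a₂↔b))` (the gain of `x` from gluing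
the pair; `max_j G_{a_j} = μ(a₁↔b ∪ a₂↔b) − min_j μ(a_j↔b)`).  The **mixture Lemma 4** at this instance is the inequality

  `(ψ_A + ψ_c) · G_o ≤ ψ_A · max_j G_{a_j} + ψ_c · G_c`                                                      (ML4)

(Kozma–Nitzan's Lemma 4 `G_o ≤ max_j G_{a_j}` pulled towards the spectator's gain with the Theorem-1 weights of `{glued pair, c}` in
`G/{a₁,a₂}`; registered stub `stub_mixtureLemma4_c8`; numerically 0 violations incl. adversarial search, crux memo LeadMath-c8.md).

* `threeRelays_eform_of_mixtureLemma4` — ML4 for the pair `{a₁,a₂}` with spectator `a₃`, together with `1 − t ≤ μ(a_i↔b)` (`i=1,2,3`),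
  gives the three-relay E-form `μ((o↔a₁ ∪ o↔a₂ ∪ o↔a₃) ∖ o↔b) ≤ t` — no tie, no region hypothesis.  Proof: ML4 plus the three
  reliability bounds and the nonnegativity of the two room terms is the two-step hypothesis (★★) of the landed
  `twoStep_threeRelays_eform` (seat png-dp-al5).
[cite: KozmaNitzan2024, Theorem 1 / (6) (pp. 7–8), Lemma 4 / eq. (8)–(9) (pp. 9–10), Question 7 (p. 36)]
-/

namespace Summit.CriticalPhenomena.PercolationContinuityZ3.Theorems

open MeasureTheory Set Literature.Probability.LatticeModels Literature.Probability.Percolation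

noncomputable section
open Classical

variable {n : ℕ}

/-- **Three-relay E-form from the mixture Lemma 4 at one pair.**  If (ML4) holds for the glued pair `{a₁,a₂}` with spectator `a₃`
and observer `o`, and `1 − t ≤ μ(a_i ↔ b)` for `i = 1, 2, 3`, then `μ((o↔a₁ ∪ o↔a₂ ∪ o↔a₃) ∖ o↔b) ≤ t`.
[cite: KozmaNitzan2024, Theorem 1 / (6) (pp. 7–8), Lemma 4 (p. 9), Question 7 (p. 36)] -/
theorem threeRelays_eform_of_mixtureLemma4 (w : Sym2 (Fin n) → unitInterval) (o b a₁ a₂ a₃ : Fin n) (t : ℝ)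
    (h12 : a₁ ≠ a₂) (h13 : a₁ ≠ a₃)
    (ht1 : 1 - t ≤ (prodBernoulli w).real (openConn a₁ b)) (ht2 : 1 - t ≤ (prodBernoulli w).real (openConn a₂ b))
    (ht3 : 1 - t ≤ (prodBernoulli w).real (openConn a₃ b))
    (hML :
      ((prodBernoulli w).real ((openConn a₃ a₁)ᶜ ∩ (openConn a₃ a₂)ᶜ ∩ (openConn o a₁ ∪ openConn o a₂)) +
            (prodBernoulli w).real ((openConn a₃ a₁)ᶜ ∩ (openConn a₃ a₂)ᶜ ∩ openConn o a₃)) *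
          (prodBernoulli w).real ((openConn o b)ᶜ ∩ (openConn o a₁ ∪ openConn o a₂) ∩ (openConn a₁ b ∪ openConn a₂ b)) ≤
        (prodBernoulli w).real ((openConn a₃ a₁)ᶜ ∩ (openConn a₃ a₂)ᶜ ∩ (openConn o a₁ ∪ openConn o a₂)) *
            ((prodBernoulli w).real (openConn a₁ b ∪ openConn a₂ b) -
              min ((prodBernoulli w).real (openConn a₁ b)) ((prodBernoulli w).real (openConn a₂ b))) +
          (prodBernoulli w).real ((openConn a₃ a₁)ᶜ ∩ (openConn a₃ a₂)ᶜ ∩ openConn o a₃) *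
            (prodBernoulli w).real ((openConn a₃ b)ᶜ ∩ (openConn a₃ a₁ ∪ openConn a₃ a₂) ∩ (openConn a₁ b ∪ openConn a₂ b))) :
    (prodBernoulli w).real ((openConn o a₁ ∪ openConn o a₂ ∪ openConn o a₃) \ openConn o b) ≤ t := by
  apply twoStep_threeRelays_eform w o b a₁ a₂ a₃ t h12 h13 ht1 ht2
  have hψ1 : 0 ≤ (prodBernoulli w).real ((openConn a₃ a₁)ᶜ ∩ (openConn a₃ a₂)ᶜ ∩ (openConn o a₁ ∪ openConn o a₂)) :=
    measureReal_nonneg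
  have hψ2 : 0 ≤ (prodBernoulli w).real ((openConn a₃ a₁)ᶜ ∩ (openConn a₃ a₂)ᶜ ∩ openConn o a₃) := measureReal_nonneg
  have hR1 : 0 ≤ (prodBernoulli w).real ((openConn o a₁ ∪ openConn o a₂ ∪ openConn o a₃)ᶜ ∩ (openConn a₁ b ∪ openConn a₂ b) ∩
      (openConn a₃ b)ᶜ ∩ ((openConn a₃ a₁)ᶜ ∩ (openConn a₃ a₂)ᶜ)) := measureReal_nonneg
  have hR2 : 0 ≤ (prodBernoulli w).real ((openConn o a₁ ∪ openConn o a₂ ∪ openConn o a₃)ᶜ ∩ openConn a₃ b ∩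
      (openConn a₁ b ∪ openConn a₂ b)ᶜ) := measureReal_nonneg
  have hmin : 1 - t ≤ min ((prodBernoulli w).real (openConn a₁ b)) ((prodBernoulli w).real (openConn a₂ b)) := le_min ht1 ht2
  have k1 := mul_le_mul_of_nonneg_left hmin hψ1
  have k2 := mul_le_mul_of_nonneg_left ht3 hψ2
  have r1 := mul_nonneg hψ2 hR1
  have r2 := mul_nonneg hψ1 hR2
  nlinarith [hML, k1, k2, r1, r2]

end

end Summit.CriticalPhenomena.PercolationContinuityZ3.Theorems
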